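import Literature.NumberTheory.PAdicHodge.AinfWeierstrassEtaPeriod
import Literature.NumberTheory.EllipticCurves.FormalGroupHasseInvariantProofs
import HarnessLib

/-!
# Uniform boundedness of the periods `∫_t ω`, `∫_t η` modulo `Fil^k B_dR⁺`: `k!·∫_t ω, k!·∫_t η ∈ ι(𝔸_inf) + Fil^k`

Topic `Literature/NumberTheory/PAdicHodge`; THEOREMS ONLY. In Fontaine's topology of `B_dR⁺` (lattices
`Λ(N,k) = p^N ι(𝔸_inf) + ξ^k B_dR⁺`, tree `BdRPlusGaloisContinuity`, `BdRPlusLatticeSeparated`) a family of elements is BOUNDED modulo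
`Fil^k` when a fixed power of `p` multiplies it into `ι(𝔸_inf) + Fil^k`. The period maps of a formal group evaluate series
`f = Σ fₙ Xⁿ ∈ ℚ⟦X⟧` whose denominators are controlled (`n·fₙ ∈ ℤ`: `f = log_W = ∫ω` or `η₀ = ∫(xω − dz/z²)`, with `ω`,
`xω − dz/z²` INTEGRAL) at points `x = ι(a) ∈ Fil¹` coming from `𝔸_inf` (Fontaine's elements `[t] ∈ ξ𝔸_inf`); then

  `k! · f(x) = Σ_{n<k} (k! fₙ) ι(a)ⁿ + x^k·(…) ∈ ι(𝔸_inf) + Fil^k`   uniformly in `x`.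

* §1 `BdRPlusTop.exists_eq_ofAinf_add_of_coeff` — the displayed statement for any `f ∈ RatCoeff⟦X⟧`, `D ∈ ℤ` with `D·fₙ ∈ ℤ` (`n < k`);
* §2 the denominators of `log_W` and `η₀`: `k!·coeff n (logSeries W) ∈ ℤ`, `k!·coeff n (etaSeries W) ∈ ℤ` for `n ≤ k`
  (`(n+1)·log_{n+1} = ωₙ`, `(n+1)·η₀,ₙ₊₁ = gₙ` with `ω = formalInvDiff`, `g = formalQuasiPeriodIntegrand` integral);
* §3 **`omegaPeriod_bounded`, `etaPeriodMain_bounded`, `etaPeriod_bounded`**: `k!·∫_t ω`, `k!·η₀([t])`, `k!·∫_t η ∈ ofAinf(𝔸_inf) + Fil^k`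
  for every `[p]`-compatible `t` (the correction `ι(corr t)` of `∫_t η` is already in `ι(𝔸_inf)`).

This is the input of the `ℤ_p`-linearity / continuity of `omegaPeriodHom`, `etaPeriodHom` (sequel). BSD context: crux K★
`stmt-BirchSwinnertonDyer-22226`, hDR sector (iii) road (A), step (E0b). BSD is not proved by any of this.

## References
* J.-M. Fontaine, *Le corps des périodes p-adiques*, Astérisque 223 (1994), Exp. II §1.5.3–1.5.4. [FontaineAsterisque223III]
* P. Colmez, *Périodes p-adiques des variétés abéliennes*, Math. Ann. 292 (1992), §2. [Colmez1992PeriodesAbeliennes]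
* J. H. Silverman, *The Arithmetic of Elliptic Curves* (2009), IV.1, IV.5. [SilvermanAEC2009]
-/

noncomputable section

open Ideal Filter Topology Field WittVector MvPowerSeries

namespace Literature.NumberTheory.PAdicHodge

open Literature.NumberTheory.GaloisRepresentations
open Literature.NumberTheory.GaloisRepresentations.IsNonarchimedeanLocalField
open Literature.NumberTheory.GaloisRepresentations.LubinTate

/-! ## §1 Series with controlled denominators at points from `𝔸_inf` -/

namespace BdRPlusTop

variable {F : Type} [Field F] [ValuativeRel F] [TopologicalSpace F] [IsNonarchimedeanLocalField F] [CharZero F]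
  {p : ℕ} [Fact p.Prime] [Fact (¬ IsUnit (p : integerC F))]
  [IsAdicComplete (Ideal.span {(p : integerC F)}) (integerC F)]

/-- **Uniform boundedness modulo `Fil^k`**: if `D·fₙ ∈ ℤ` for `n < k` and `x = ι(a) ∈ Fil¹` (`a ∈ 𝔸_inf`), then
`D·f(x) = ι(b) + ξ_dR^k·w` for some `b ∈ 𝔸_inf`, `w ∈ B_dR⁺` — namely `b = Σ_{n<k} (D fₙ) aⁿ`.
[cite: FontaineAsterisque223III, Exp. II §1.5.3] -/
theorem exists_eq_ofAinf_add_of_coeff (f : PowerSeries RatCoeff) (hf : PowerSeries.constantCoeff f = 0) (k : ℕ) (D : ℤ)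
    (hD : ∀ n, n < k → ∃ z : ℤ, (D : RatCoeff) * PowerSeries.coeff n f = (z : RatCoeff)) {a : Ainf (p := p) F}
    (ha : ofAinf F p a ∈ (filOne F p).toIdeal) :
    ∃ (b : Ainf (p := p) F) (w : BdRPlusTop F p),
      (D : BdRPlusTop F p) * (evalPt₁ (filOne F p) f hf ⟨ofAinf F p a, ha⟩ : BdRPlusTop F p) = ofAinf F p b + of F p xiBdR ^ k * w := by
  choose! z hz using hD
  set P : PowerSeries RatCoeff := ∑ n ∈ Finset.range k, PowerSeries.C ((z n : ℤ) : RatCoeff) * PowerSeries.X ^ n with hP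
  have hdvd : (PowerSeries.X : PowerSeries RatCoeff) ^ k ∣ PowerSeries.C (D : RatCoeff) * f - P := by
    rw [PowerSeries.X_pow_dvd_iff]
    intro m hm
    rw [map_sub, PowerSeries.coeff_C_mul, hz m hm, hP, map_sum]
    simp_rw [PowerSeries.coeff_C_mul_X_pow]
    rw [Finset.sum_ite_eq, if_pos (Finset.mem_range.2 hm), sub_self]
  obtain ⟨h, hh⟩ := hdvd
  set x : (filOne F p).toIdeal := ⟨ofAinf F p a, ha⟩ with hxdef
  have hx := (filOne F p).hasEval fun _ : Unit => x
  have hX : aeval hx (PowerSeries.X : PowerSeries RatCoeff) = ofAinf F p a := aeval_X' hx ()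
  have hC : ∀ c : RatCoeff, aeval hx (PowerSeries.C c) = algebraMap RatCoeff (BdRPlusTop F p) c := fun c => by
    rw [PowerSeries.C_eq_algebraMap]
    exact (aeval hx).commutes c
  have hdec : PowerSeries.C (D : RatCoeff) * f = P + PowerSeries.X ^ k * h := by rw [← hh]; ring
  have key : (D : BdRPlusTop F p) * aeval hx f = aeval hx P + ofAinf F p a ^ k * aeval hx h := by
    have h2 := congrArg (aeval hx) hdec
    rw [map_mul, map_add, map_mul, map_pow, hX, hC, map_intCast] at h2
    exact h2
  have hPval : aeval hx P = ofAinf F p (∑ n ∈ Finset.range k, (z n : Ainf (p := p) F) * a ^ n) := by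
    rw [hP, map_sum, map_sum]
    refine Finset.sum_congr rfl fun n _ => ?_
    rw [map_mul, map_pow, hX, hC, map_intCast, map_mul, map_pow, map_intCast]
  obtain ⟨c, hc⟩ := Ideal.mem_span_singleton'.1 (show ofAinf F p a ∈ Ideal.span {of F p xiBdR} from ha)
  refine ⟨∑ n ∈ Finset.range k, (z n : Ainf (p := p) F) * a ^ n, c ^ k * aeval hx h, ?_⟩
  change (D : BdRPlusTop F p) * aeval hx f = _
  rw [key, hPval, ← hc]
  ring

end BdRPlusTop

/-! ## §2 Denominators of `log_W` and `η₀` -/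

namespace AinfTop

variable {F : Type} [Field F] [ValuativeRel F] [TopologicalSpace F] [IsNonarchimedeanLocalField F] [CharZero F]
  {p : ℕ} [Fact p.Prime] [Fact (¬ IsUnit (p : integerC F))]
  [IsAdicComplete (Ideal.span {(p : integerC F)}) (integerC F)]
  {hθ : Function.Surjective (fontaineTheta (integerC F) p)}
  (W : WeierstrassCurve ℤ)

omit [CharZero F] [Fact p.Prime] [Fact (¬ IsUnit (p : integerC F))] [IsAdicComplete (Ideal.span {(p : integerC F)}) (integerC F)] in
/-- `(n+1)·coeff (n+1) log_W = ωₙ ∈ ℤ` (`d log_W = ω = formalInvDiff`, integral). [cite: SilvermanAEC2009, IV.5.5] -/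
theorem succ_mul_coeff_succ_logSeries (n : ℕ) :
    ((n : RatCoeff) + 1) * PowerSeries.coeff (n + 1) (logSeries W) =
      ((PowerSeries.coeff n W.formalInvDiff : ℤ) : RatCoeff) := by
  have h := congrArg (PowerSeries.coeff n) (W.map (Int.castRingHom ℚ)).derivative_formalLog
  rw [PowerSeries.coeff_derivative, ← WeierstrassCurve.formalInvDiff_eq_formalOmega, ← WeierstrassCurve.map_formalInvDiff,
    PowerSeries.coeff_map, eq_intCast] at h
  rw [logSeries, PowerSeries.coeff_map, mul_comm, ← map_natCast RatCoeff.of.toRingHom n, ← map_one RatCoeff.of.toRingHom, ← map_add,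
    ← map_mul, h, map_intCast]

omit [CharZero F] [Fact p.Prime] [Fact (¬ IsUnit (p : integerC F))] [IsAdicComplete (Ideal.span {(p : integerC F)}) (integerC F)] in
/-- `(n+1)·coeff (n+1) η₀ = gₙ ∈ ℤ` (`g = formalQuasiPeriodIntegrand` integral). [cite: Katz1981CrystallineDieudonne, §5.1] -/
theorem succ_mul_coeff_succ_etaSeries (n : ℕ) :
    ((n : RatCoeff) + 1) * PowerSeries.coeff (n + 1) (etaSeries W) =
      ((PowerSeries.coeff n W.formalQuasiPeriodIntegrand : ℤ) : RatCoeff) := by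
  rw [etaSeries, PowerSeries.coeff_map, WeierstrassCurve.coeff_succ_formalQuasiPeriod, ← WeierstrassCurve.map_formalQuasiPeriodIntegrand,
    PowerSeries.coeff_map, eq_intCast, map_mul, map_intCast, ← mul_assoc]
  have h1 : ((n : RatCoeff) + 1) * RatCoeff.of.toRingHom (algebraMap ℚ ℚ (1 / (n + 1 : ℚ))) = 1 := by
    rw [Algebra.algebraMap_self, RingHom.id_apply, ← map_natCast RatCoeff.of.toRingHom n, ← map_one RatCoeff.of.toRingHom, ← map_add,
      ← map_mul, mul_one_div_cancel (Nat.cast_add_one_ne_zero n)]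
  rw [h1, one_mul]

omit [CharZero F] [Fact p.Prime] [Fact (¬ IsUnit (p : integerC F))] [IsAdicComplete (Ideal.span {(p : integerC F)}) (integerC F)] in
/-- From `(n+1)·f_{n+1} ∈ ℤ` to `k!·fₙ ∈ ℤ` for `n ≤ k`. [folklore] -/
private theorem exists_factorial_mul_coeff_eq (f : PowerSeries RatCoeff) (hf0 : PowerSeries.constantCoeff f = 0) (c : ℕ → ℤ)
    (hf : ∀ n : ℕ, ((n : RatCoeff) + 1) * PowerSeries.coeff (n + 1) f = ((c n : ℤ) : RatCoeff)) (k n : ℕ) (hn : n < k + 1) :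
    ∃ z : ℤ, ((k.factorial : ℤ) : RatCoeff) * PowerSeries.coeff n f = (z : RatCoeff) := by
  rcases n with _ | m
  · exact ⟨0, by rw [PowerSeries.coeff_zero_eq_constantCoeff, hf0, mul_zero, Int.cast_zero]⟩
  · have hdvd : m + 1 ∣ k.factorial := Nat.dvd_factorial (Nat.succ_pos m) (by omega)
    obtain ⟨q, hq⟩ := hdvd
    refine ⟨(q : ℤ) * c m, ?_⟩
    rw [hq, Nat.cast_mul, Int.cast_mul, Int.cast_natCast, Int.cast_mul, Int.cast_natCast, ← hf m, Nat.cast_succ]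
    ring

/-! ## §3 The periods are bounded modulo `Fil^k` -/

/-- **`k!·∫_t ω ∈ ι(𝔸_inf) + Fil^k B_dR⁺`**, uniformly in the `[p]`-compatible sequence `t`. [cite: FontaineAsterisque223III, Exp. II §1.5.3]
[cite: Colmez1992PeriodesAbeliennes, §2] -/
theorem omegaPeriod_bounded (k : ℕ) {t : ℕ → (maxNilIdealC F).toIdeal} (ht0 : (t 0 : CBall F) = 0)
    (htp : ∀ n, mulPC F p W (t (n + 1)) = t n) :
    ∃ (b : Ainf (p := p) F) (w : BdRPlusTop F p),
      ((k.factorial : ℤ) : BdRPlusTop F p) * omegaPeriod W hθ t ht0 htp = BdRPlusTop.ofAinf F p b + BdRPlusTop.of F p xiBdR ^ k * w :=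
  BdRPlusTop.exists_eq_ofAinf_add_of_coeff (logSeries W) (constantCoeff_logSeries W) k _
    (fun n hn => exists_factorial_mul_coeff_eq (logSeries W) (constantCoeff_logSeries W) _ (succ_mul_coeff_succ_logSeries W) k n
      (by omega))
    (BdRPlusTop.ofAinf_mem_filOne (torsionLift_mem_span_xi W ht0 htp))

/-- **`k!·η₀([t]) ∈ ι(𝔸_inf) + Fil^k B_dR⁺`**, uniformly in `t`. [cite: Colmez1992PeriodesAbeliennes, §2] -/
theorem etaPeriodMain_bounded (k : ℕ) {t : ℕ → (maxNilIdealC F).toIdeal} (ht0 : (t 0 : CBall F) = 0)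
    (htp : ∀ n, mulPC F p W (t (n + 1)) = t n) :
    ∃ (b : Ainf (p := p) F) (w : BdRPlusTop F p),
      ((k.factorial : ℤ) : BdRPlusTop F p) * etaPeriodMain W hθ t ht0 htp = BdRPlusTop.ofAinf F p b + BdRPlusTop.of F p xiBdR ^ k * w :=
  BdRPlusTop.exists_eq_ofAinf_add_of_coeff (etaSeries W) (constantCoeff_etaSeries W) k _
    (fun n hn => exists_factorial_mul_coeff_eq (etaSeries W) (constantCoeff_etaSeries W) _ (succ_mul_coeff_succ_etaSeries W) k n
      (by omega))
    (BdRPlusTop.ofAinf_mem_filOne (torsionLift_mem_span_xi W ht0 htp))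

/-- **`k!·∫_t η ∈ ι(𝔸_inf) + Fil^k B_dR⁺`**, uniformly in `t` (`∫_t η = η₀([t]) − ι(corr t)` and `ι(corr t) ∈ ι(𝔸_inf)`).
[cite: Colmez1992PeriodesAbeliennes, §2] -/
theorem etaPeriod_bounded (k : ℕ) {t : ℕ → (maxNilIdealC F).toIdeal} (ht0 : (t 0 : CBall F) = 0)
    (htp : ∀ n, mulPC F p W (t (n + 1)) = t n) :
    ∃ (b : Ainf (p := p) F) (w : BdRPlusTop F p),
      ((k.factorial : ℤ) : BdRPlusTop F p) * etaPeriod W hθ t ht0 htp = BdRPlusTop.ofAinf F p b + BdRPlusTop.of F p xiBdR ^ k * w := by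
  obtain ⟨b, w, h⟩ := etaPeriodMain_bounded W (hθ := hθ) k ht0 htp
  refine ⟨b - (k.factorial : ℤ) * (of F p).symm (etaCorr W hθ t htp), w, ?_⟩
  rw [etaPeriod, mul_sub, h, map_sub, map_mul, map_intCast]
  ring

end AinfTop

end Literature.NumberTheory.PAdicHodge

end
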